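import Summits.BirchSwinnertonDyer.BirchSwinnertonDyer.Theorems.TameQuarticManinParityTwistPartnerOptimalDatumOfFacts
import Summits.BirchSwinnertonDyer.BirchSwinnertonDyer.Theorems.TameQuarticManinParityIrrManinUnitOfIIIHalf
import Summits.BirchSwinnertonDyer.BirchSwinnertonDyer.Theorems.TameQuarticManinParityIrrManinUnitOfIIIstarHalf
import Summits.BirchSwinnertonDyer.BirchSwinnertonDyer.Theorems.TameQuarticManinParityIrrManinLeOfOrientation
import Summits.BirchSwinnertonDyer.BirchSwinnertonDyer.Theorems.TameQuarticManinParityDegreePrimeToThreeOfCNS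
import Summits.BirchSwinnertonDyer.BirchSwinnertonDyer.Theorems.TameQuarticManinParityDegreeSplitGlue
import HarnessLib

/-!
# Route `TameQuarticManinParity`, LINE 22 (bsd-idea-3 g8): the irreducible organ `TprimeIrrManinUnitOfThreeDvdDegree`
# (stmt-BirchSwinnertonDyer-24498) and its parent `TprimeIrreducibleManinUnit` (23736) reduced BY NAME to ONE Kodaira
# half, GRANTED the three published inputs {modularity, Dokchitser–Dokchitser 2015 Thm 5.1(1), Česnavičius–Neururer–Saha}

Cell `pub/bsd-wall`, D-0145 line `route-BirchSwinnertonDyer-TeichmullerTwistDescent`, seat `bsd-line-ttd-p1` g10,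
working the planner-of-record's TQMP LINE 22 (`--supports` 24498; bookkeeping). BSD is NOT proved by this; Manin's
conjecture is not proved by this; the organ 24498 and its parent 23736 remain OPEN — every statement below keeps a
KODAIRA-HALF of the organ (and, on the III* side, the orientation O22 `TprimeIrrTwistLatticeOrientation`, 28139) as
an explicit hypothesis.

With the landed pieces — X22 granted {`exists_isNewformOf`, `dokchitser_…`}
(`tprimeIrrTwistPartnerOptimalDatum_of_modularity_of_dokchitser`, this seat), the ČNS half granted ČNS
(`tprimeIrrManinUnitOfDegreePrimeToThree_of_cns`), S22 (`tprimeIrrManinLeOfOrientation_proof`), the glues G22′/G22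
(`tprimeIrrManinUnitOfIIIHalf_proof`, `tprimeIrrManinUnitOfIIIstarHalf_proof`) and the degree split
(`tprimeIrrOfDegreeSplit_proof`) — the organ and its parent follow, modulo the three published named facts, from

* the organ on the Kodaira-III rows ALONE (`…_of_pub_of_III`), or
* the orientation O22 together with the organ on the Kodaira-III* rows (`…_of_pub_of_orientation_of_IIIstar`).

Design: theorems only (compositions by name); no definition, no new named fact, no `sorry`; axioms `propext`,
`Classical.choice`, `Quot.sound`.
-/

set_option autoImplicit false
-- D-0017: single-problem summit, so `Summit.BirchSwinnertonDyer.BirchSwinnertonDyer.…` repeats a namespace BY DESIGN.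
set_option linter.dupNamespace false

noncomputable section

namespace Summit.BirchSwinnertonDyer.BirchSwinnertonDyer.Theorems.TameQuarticManinParity

open Literature.NumberTheory.EllipticCurves Literature.NumberTheory.EllipticCurves.ModularForms
  Summit.BirchSwinnertonDyer.BirchSwinnertonDyer.Theses.TameQuarticManinParity

/-! ## §1 From the Kodaira-III rows -/

/-- **Organ 24498 from its Kodaira-III rows, granted {modularity, DD2015, ČNS}.** If `3 ∤ c(D)` holds for every
X₀(N)-optimal datum `D` with `3 ∣ deg D` on the irreducible non-CM (t′) rows with `ord₃ Δ_min = 3`, then it holds on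
all irreducible non-CM (t′) rows (the III* rows borrow their type-III partner: X22 + one-sided Gauss-sum transport).
[cite: Stevens1989, Lemmas (5.2), (5.4)] [cite: DokchitserDokchitser2015LocalInvariants, Thm. 5.1 (1)]
[cite: CesnaviciusNeururerSaha2023, Thm. 1.2] -/
theorem tprimeIrrManinUnitOfThreeDvdDegree_of_pub_of_III (hnf : exists_isNewformOf)
    (hDD : dokchitser_padicValInt_minimalDiscriminantInt_eq_of_isogeny_of_not_dvd_degree)
    (hCNS : cesnaviciusNeururerSaha_padicVal_maninConstant_le_modularDegree)
    (hIII : ∀ (W : WeierstrassCurve ℚ) [W.IsElliptic] [W.IsGloballyMinimal] [NeZero (W.conductorNorm ℤ)],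
      ¬ W.HasCM → Rank1Residual.Addv W 3 → Summit.BirchSwinnertonDyer.Rank1Residual.Additive.SubTprime W 3 →
      W.HasIrreducibleModPGaloisRep 3 → padicValInt 3 W.minimalDiscriminantInt = 3 →
      ∀ (D : ModularParametrizationData W (W.conductorNorm ℤ)),
        (∀ z ∈ D.L.lattice, ∃ w ∈ periodLattice D.f, z = D.c * w) →
        (∀ (W' : WeierstrassCurve ℚ) [W'.IsElliptic] (D' : ModularParametrizationData W' (W.conductorNorm ℤ)),
          D'.f = D.f → D.modularDegree ≤ D'.modularDegree) →
        3 ∣ D.modularDegree → ¬ (3 : ℤ) ∣ D.maninConstant) :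
    TprimeIrrManinUnitOfThreeDvdDegree :=
  tprimeIrrManinUnitOfIIIHalf_proof (tprimeIrrTwistPartnerOptimalDatum_of_modularity_of_dokchitser hnf hDD)
    (tprimeIrrManinUnitOfDegreePrimeToThree_of_cns hCNS) hIII

/-- **The parent `TprimeIrreducibleManinUnit` (23736) from the Kodaira-III rows of the organ, granted {modularity,
DD2015, ČNS}** (degree split `tprimeIrrOfDegreeSplit_proof` + the ČNS half).
[cite: CesnaviciusNeururerSaha2023, Thm. 1.2] [cite: DokchitserDokchitser2015LocalInvariants, Thm. 5.1 (1)] -/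
theorem tprimeIrreducibleManinUnit_of_pub_of_III (hnf : exists_isNewformOf)
    (hDD : dokchitser_padicValInt_minimalDiscriminantInt_eq_of_isogeny_of_not_dvd_degree)
    (hCNS : cesnaviciusNeururerSaha_padicVal_maninConstant_le_modularDegree)
    (hIII : ∀ (W : WeierstrassCurve ℚ) [W.IsElliptic] [W.IsGloballyMinimal] [NeZero (W.conductorNorm ℤ)],
      ¬ W.HasCM → Rank1Residual.Addv W 3 → Summit.BirchSwinnertonDyer.Rank1Residual.Additive.SubTprime W 3 →
      W.HasIrreducibleModPGaloisRep 3 → padicValInt 3 W.minimalDiscriminantInt = 3 →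
      ∀ (D : ModularParametrizationData W (W.conductorNorm ℤ)),
        (∀ z ∈ D.L.lattice, ∃ w ∈ periodLattice D.f, z = D.c * w) →
        (∀ (W' : WeierstrassCurve ℚ) [W'.IsElliptic] (D' : ModularParametrizationData W' (W.conductorNorm ℤ)),
          D'.f = D.f → D.modularDegree ≤ D'.modularDegree) →
        3 ∣ D.modularDegree → ¬ (3 : ℤ) ∣ D.maninConstant) :
    TprimeIrreducibleManinUnit :=
  tprimeIrrOfDegreeSplit_proof (tprimeIrrManinUnitOfThreeDvdDegree_of_pub_of_III hnf hDD hCNS hIII)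
    (tprimeIrrManinUnitOfDegreePrimeToThree_of_cns hCNS)

/-! ## §2 From the orientation and the Kodaira-III* rows -/

/-- **Organ 24498 from the orientation O22 and its Kodaira-III* rows, granted {modularity, DD2015, ČNS}.** If the
orientation `Λ(D.f) ⊆ g(χ₋₃)·Λ(D.f ⊗ χ₋₃)` holds on the irreducible type-III rows (O22, stmt 28139) and `3 ∤ c(D)`
holds for every X₀(N)-optimal datum with `3 ∣ deg D` on the irreducible non-CM (t′) rows with `ord₃ Δ_min = 9`, then
the organ holds on all rows (the III rows borrow their III* partner through S22 along the orientation).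
[cite: Stevens1989, Lemmas (5.2), (5.4)] [cite: DokchitserDokchitser2015LocalInvariants, Thm. 5.1 (1)]
[cite: CesnaviciusNeururerSaha2023, Thm. 1.2] -/
theorem tprimeIrrManinUnitOfThreeDvdDegree_of_pub_of_orientation_of_IIIstar (hnf : exists_isNewformOf)
    (hDD : dokchitser_padicValInt_minimalDiscriminantInt_eq_of_isogeny_of_not_dvd_degree)
    (hCNS : cesnaviciusNeururerSaha_padicVal_maninConstant_le_modularDegree)
    (hO : TprimeIrrTwistLatticeOrientation)
    (hIIIstar : ∀ (W : WeierstrassCurve ℚ) [W.IsElliptic] [W.IsGloballyMinimal] [NeZero (W.conductorNorm ℤ)],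
      ¬ W.HasCM → Rank1Residual.Addv W 3 → Summit.BirchSwinnertonDyer.Rank1Residual.Additive.SubTprime W 3 →
      W.HasIrreducibleModPGaloisRep 3 → padicValInt 3 W.minimalDiscriminantInt = 9 →
      ∀ (D : ModularParametrizationData W (W.conductorNorm ℤ)),
        (∀ z ∈ D.L.lattice, ∃ w ∈ periodLattice D.f, z = D.c * w) →
        (∀ (W' : WeierstrassCurve ℚ) [W'.IsElliptic] (D' : ModularParametrizationData W' (W.conductorNorm ℤ)),
          D'.f = D.f → D.modularDegree ≤ D'.modularDegree) →
        3 ∣ D.modularDegree → ¬ (3 : ℤ) ∣ D.maninConstant) :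
    TprimeIrrManinUnitOfThreeDvdDegree :=
  tprimeIrrManinUnitOfIIIstarHalf_proof (tprimeIrrTwistPartnerOptimalDatum_of_modularity_of_dokchitser hnf hDD)
    hO tprimeIrrManinLeOfOrientation_proof (tprimeIrrManinUnitOfDegreePrimeToThree_of_cns hCNS) hIIIstar

/-- **The parent `TprimeIrreducibleManinUnit` (23736) from O22 and the Kodaira-III* rows of the organ, granted
{modularity, DD2015, ČNS}.** [cite: CesnaviciusNeururerSaha2023, Thm. 1.2]
[cite: DokchitserDokchitser2015LocalInvariants, Thm. 5.1 (1)] -/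
theorem tprimeIrreducibleManinUnit_of_pub_of_orientation_of_IIIstar (hnf : exists_isNewformOf)
    (hDD : dokchitser_padicValInt_minimalDiscriminantInt_eq_of_isogeny_of_not_dvd_degree)
    (hCNS : cesnaviciusNeururerSaha_padicVal_maninConstant_le_modularDegree)
    (hO : TprimeIrrTwistLatticeOrientation)
    (hIIIstar : ∀ (W : WeierstrassCurve ℚ) [W.IsElliptic] [W.IsGloballyMinimal] [NeZero (W.conductorNorm ℤ)],
      ¬ W.HasCM → Rank1Residual.Addv W 3 → Summit.BirchSwinnertonDyer.Rank1Residual.Additive.SubTprime W 3 →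
      W.HasIrreducibleModPGaloisRep 3 → padicValInt 3 W.minimalDiscriminantInt = 9 →
      ∀ (D : ModularParametrizationData W (W.conductorNorm ℤ)),
        (∀ z ∈ D.L.lattice, ∃ w ∈ periodLattice D.f, z = D.c * w) →
        (∀ (W' : WeierstrassCurve ℚ) [W'.IsElliptic] (D' : ModularParametrizationData W' (W.conductorNorm ℤ)),
          D'.f = D.f → D.modularDegree ≤ D'.modularDegree) →
        3 ∣ D.modularDegree → ¬ (3 : ℤ) ∣ D.maninConstant) :
    TprimeIrreducibleManinUnit :=
  tprimeIrrOfDegreeSplit_proof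
    (tprimeIrrManinUnitOfThreeDvdDegree_of_pub_of_orientation_of_IIIstar hnf hDD hCNS hO hIIIstar)
    (tprimeIrrManinUnitOfDegreePrimeToThree_of_cns hCNS)

end Summit.BirchSwinnertonDyer.BirchSwinnertonDyer.Theorems.TameQuarticManinParity

end
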